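import Literature.Geometry.Kaehler.ChartWindowCurrent
import Literature.Geometry.Kaehler.HolomorphicChainTangentConeRegular

/-!
# The affine projection and the tube cutoff of a chart window

For a chart window `W` (`ChartWindow.lean`) we record two more gadgets used to read the blow-ups
of a holomorphic chain in the window:

* `ChartWindow.proj` — **the affine orthogonal projection `q(x) = m + P_K(x − m)`** onto the
  affine tangent plane `m + K` (smooth, `k ∘ q = k`, `q = id` on the plane, `‖Dq‖ ≤ 1`);
* `ChartWindow.cutoff` — **a smooth compactly supported cutoff `χ ∈ 𝒟⁰(V)`** with
  `χ = 1` on the open set `{‖k‖ < a_lo, ‖w‖ < τ/8}` (`a_lo = (2a₃ + a₂)/3 > a₃`) and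
  `spt χ ⊆ {‖k‖ ≤ a₂, ‖w‖ ≤ τ/5} ⊆ innerCore ∪ …` — more precisely
  `tsupport χ ⊆ {‖k‖ ≤ a₂ ∧ ‖w‖ ≤ τ/5}` (`ChartWindow.tsupport_cutoff_subset`), `0 ≤ χ ≤ 1`.

The closed tube `{‖k‖ ≤ a₁, ‖w‖ ≤ τ}` is compact (`ChartWindow.isCompact_closedTube`).

Definitions with bodies + theorems; no named facts.

## References

* H. Federer, *Geometric Measure Theory*, Springer 1969, 4.1.7, 4.3.18 [Federer1969].
-/

noncomputable section

open scoped Manifold Topology ContDiff Distributions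
open Set Filter Metric Function Module TopologicalSpace Real

namespace Literature.Geometry.Kaehler

open Literature.Geometry.GeometricMeasureTheory

universe u

variable {V : Type u} [NormedAddCommGroup V] [InnerProductSpace ℂ V] [FiniteDimensional ℂ V]

namespace ChartWindow

variable (W : ChartWindow V)

/-! ### The affine projection onto the tangent plane -/

/-- **`q(x) = m + P_K(x − m)`**, the orthogonal projection onto the affine plane `m + K`.
[folklore] -/
def proj (x : V) : V := W.m + ((W.kf x : W.K) : V)

/-- `q` is smooth. [folklore] -/
theorem contDiff_proj : ContDiff ℝ ∞ W.proj :=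
  contDiff_const.add ((W.K.subtypeL.restrictScalars ℝ).contDiff.comp W.contDiff_kf)

/-- `k ∘ q = k`. [folklore] -/
theorem kf_proj (x : V) : W.kf (W.proj x) = W.kf x := by
  simp only [kf, proj, add_sub_cancel_left]
  exact W.K.orthogonalProjectionOnto_mem_subspace_eq_self _

/-- `q x − m ∈ K`. [folklore] -/
theorem proj_sub_mem (x : V) : W.proj x - W.m ∈ W.K := by
  simp [proj]

/-- `q x = x` for `x ∈ m + K`. [folklore] -/
theorem proj_eq_self {x : V} (hx : x - W.m ∈ W.K) : W.proj x = x := by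
  have : ((W.kf x : W.K) : V) = x - W.m := by
    simp only [kf]
    have := W.K.starProjection_eq_self_iff.2 hx
    rwa [Submodule.starProjection_apply] at this
  rw [proj, this, add_sub_cancel]

/-- `D q = ι_K ∘ P_K`. [folklore] -/
theorem hasFDerivAt_proj (x : V) :
    HasFDerivAt W.proj ((W.K.subtypeL.restrictScalars ℝ).comp
      (W.K.orthogonalProjectionOnto.restrictScalars ℝ)) x := by
  have hk : HasFDerivAt W.kf (W.K.orthogonalProjectionOnto.restrictScalars ℝ) x := by
    have h := ((W.K.orthogonalProjectionOnto.restrictScalars ℝ).hasFDerivAt (x := x - W.m)).comp x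
      ((hasFDerivAt_id x).sub_const W.m)
    rw [ContinuousLinearMap.comp_id] at h
    exact h
  have h := ((W.K.subtypeL.restrictScalars ℝ).hasFDerivAt).comp x hk
  exact h.const_add W.m

/-- `‖D q‖ ≤ 1`. [folklore] -/
theorem norm_fderiv_proj_le (x : V) : ‖fderiv ℝ W.proj x‖ ≤ 1 := by
  rw [(W.hasFDerivAt_proj x).fderiv]
  refine ContinuousLinearMap.opNorm_le_bound _ zero_le_one fun v => ?_
  rw [one_mul]
  simp only [ContinuousLinearMap.coe_comp, comp_apply, ContinuousLinearMap.coe_restrictScalars',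
    Submodule.subtypeL_apply]
  exact (W.K.norm_orthogonalProjectionOnto_apply_le v :)

/-! ### The closed tube is compact -/

/-- The closed tube `{‖k‖ ≤ a₁, ‖w‖ ≤ τ}`. [folklore] -/
def closedTube : Set V := {x | ‖W.kf x‖ ≤ W.a₁ ∧ ‖W.wf x‖ ≤ W.τ}

/-- Membership in the closed tube. [folklore] -/
theorem mem_closedTube_iff {x : V} : x ∈ W.closedTube ↔ ‖W.kf x‖ ≤ W.a₁ ∧ ‖W.wf x‖ ≤ W.τ := Iff.rfl

/-- `tube ⊆ closedTube`. [folklore] -/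
theorem tube_subset_closedTube : W.tube ⊆ W.closedTube := fun _ hx => ⟨hx.1.le, hx.2.le⟩

/-- A sublevel set `{‖k‖ ≤ a, ‖w‖ ≤ t}` with `a < ρ` is closed. [folklore] -/
theorem isClosed_sublevel {a t : ℝ} (ha : a < W.ρ) : IsClosed {x : V | ‖W.kf x‖ ≤ a ∧ ‖W.wf x‖ ≤ t} := by
  have h1 : IsClosed {x : V | ‖W.kf x‖ ≤ a} :=
    isClosed_le (continuous_norm.comp W.contDiff_kf.continuous) continuous_const
  have h2 : ContinuousOn (fun x => ‖W.wf x‖) {x : V | ‖W.kf x‖ ≤ a} :=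
    (continuous_norm.comp_continuousOn W.contDiffOn_wf.continuousOn).mono fun x hx =>
      lt_of_le_of_lt hx ha
  have := h2.preimage_isClosed_of_isClosed h1 (isClosed_Iic (a := t))
  convert this using 1
  ext x
  simp [preimage]

/-- A sublevel set `{‖k‖ ≤ a, ‖w‖ ≤ t}` with `a < ρ` is bounded. [folklore] -/
theorem isBounded_sublevel {a t M : ℝ} (ha : a < W.ρ) (hM : ∀ k ∈ ball (0 : W.K) W.ρ, ‖fderiv ℂ W.Ψ k‖ ≤ M) :
    Bornology.IsBounded {x : V | ‖W.kf x‖ ≤ a ∧ ‖W.wf x‖ ≤ t} := by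
  have ha0 : ∀ x ∈ {x : V | ‖W.kf x‖ ≤ a ∧ ‖W.wf x‖ ≤ t}, ‖x - W.m‖ ≤ t + max M 0 * a + ‖W.Ψ 0 - W.m‖ := by
    rintro x ⟨hk, hw⟩
    have hkρ : W.kf x ∈ ball (0 : W.K) W.ρ := mem_ball_zero_iff.2 (lt_of_le_of_lt hk ha)
    have hlip := W.lipschitzOnWith_chart le_rfl (M := max M 0) fun k hk => (hM k hk).trans (le_max_left _ _)
    have h1 : ‖W.Ψ (W.kf x) - W.Ψ 0‖ ≤ max M 0 * a := by
      have := hlip.norm_sub_le hkρ (mem_ball_self W.ρ_pos)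
      rw [sub_zero, Real.coe_toNNReal _ (le_max_right _ _)] at this
      exact this.trans (mul_le_mul_of_nonneg_left hk (le_max_right _ _))
    calc ‖x - W.m‖ = ‖W.wf x + (W.Ψ (W.kf x) - W.Ψ 0) + (W.Ψ 0 - W.m)‖ := by
          congr 1; simp only [wf]; abel
      _ ≤ ‖W.wf x‖ + ‖W.Ψ (W.kf x) - W.Ψ 0‖ + ‖W.Ψ 0 - W.m‖ := norm_add₃_le
      _ ≤ t + max M 0 * a + ‖W.Ψ 0 - W.m‖ := by gcongr
  refine (isBounded_iff_forall_norm_le.2 ⟨t + max M 0 * a + ‖W.Ψ 0 - W.m‖ + ‖W.m‖, ?_⟩)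
  intro x hx
  calc ‖x‖ = ‖(x - W.m) + W.m‖ := by rw [sub_add_cancel]
    _ ≤ ‖x - W.m‖ + ‖W.m‖ := norm_add_le _ _
    _ ≤ _ := by linarith [ha0 x hx]

/-- **The closed tube is compact** (given a derivative bound for the chart). [folklore] -/
theorem isCompact_closedTube {M : ℝ} (hM : ∀ k ∈ ball (0 : W.K) W.ρ, ‖fderiv ℂ W.Ψ k‖ ≤ M) :
    IsCompact W.closedTube := by
  haveI : FiniteDimensional ℝ V := FiniteDimensional.complexToReal V
  haveI : ProperSpace V := FiniteDimensional.proper ℝ V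
  exact Metric.isCompact_of_isClosed_isBounded (W.isClosed_sublevel W.a₁_lt)
    (W.isBounded_sublevel W.a₁_lt hM)

/-! ### The cutoff -/

/-- The lateral radius `a_lo = (2a₃ + a₂)/3 ∈ (a₃, a₂)` up to which the cutoff is `1`. [folklore] -/
def aLo : ℝ := (2 * W.a₃ + W.a₂) / 3

/-- `a₃ < a_lo`. [folklore] -/
theorem a₃_lt_aLo : W.a₃ < W.aLo := by unfold aLo; linarith [W.a₃_lt]

/-- `a_lo < a₂`. [folklore] -/
theorem aLo_lt_a₂ : W.aLo < W.a₂ := by unfold aLo; linarith [W.a₃_lt]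

/-- The lateral factor `σ((a₂² − ‖k‖²)/(a₂² − a_lo²))` of the cutoff. [folklore] -/
def cutLat (x : V) : ℝ := smoothTransition ((W.a₂ ^ 2 - ‖W.kf x‖ ^ 2) / (W.a₂ ^ 2 - W.aLo ^ 2))

/-- The vertical factor `σ(((τ/5)² − ‖w‖²)/((τ/5)² − (τ/8)²))` of the cutoff. [folklore] -/
def cutVert (x : V) : ℝ := smoothTransition (((W.τ / 5) ^ 2 - ‖W.wf x‖ ^ 2) / ((W.τ / 5) ^ 2 - (W.τ / 8) ^ 2))

/-- The cutoff function `χ = cutLat · cutVert`. [folklore] -/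
def cutFun (x : V) : ℝ := W.cutLat x • W.cutVert x

/-- `cutLat = 0` where `‖k‖ ≥ a₂`. [folklore] -/
theorem cutLat_eq_zero {x : V} (hx : W.a₂ ≤ ‖W.kf x‖) : W.cutLat x = 0 := by
  have h1 := W.aLo_lt_a₂
  have h0 : 0 < W.aLo := W.a₃_pos.trans W.a₃_lt_aLo
  refine smoothTransition.zero_of_nonpos (div_nonpos_of_nonpos_of_nonneg ?_ ?_)
  · nlinarith [norm_nonneg (W.kf x), W.a₂_pos]
  · nlinarith

/-- `cutLat = 1` where `‖k‖ ≤ a_lo`. [folklore] -/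
theorem cutLat_eq_one {x : V} (hx : ‖W.kf x‖ ≤ W.aLo) : W.cutLat x = 1 := by
  have h1 := W.aLo_lt_a₂
  have h0 : 0 < W.aLo := W.a₃_pos.trans W.a₃_lt_aLo
  refine smoothTransition.one_of_one_le ?_
  rw [le_div_iff₀ (by nlinarith), one_mul]
  nlinarith [norm_nonneg (W.kf x)]

/-- `cutVert = 0` where `‖w‖ ≥ τ/5`. [folklore] -/
theorem cutVert_eq_zero {x : V} (hx : W.τ / 5 ≤ ‖W.wf x‖) : W.cutVert x = 0 := by
  have hτ := W.τ_pos
  refine smoothTransition.zero_of_nonpos (div_nonpos_of_nonpos_of_nonneg ?_ ?_)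
  · nlinarith [norm_nonneg (W.wf x)]
  · nlinarith

/-- `cutVert = 1` where `‖w‖ ≤ τ/8`. [folklore] -/
theorem cutVert_eq_one {x : V} (hx : ‖W.wf x‖ ≤ W.τ / 8) : W.cutVert x = 1 := by
  have hτ := W.τ_pos
  refine smoothTransition.one_of_one_le ?_
  rw [le_div_iff₀ (by nlinarith), one_mul]
  nlinarith [norm_nonneg (W.wf x)]

/-- `0 ≤ cutFun ≤ 1`. [folklore] -/
theorem cutFun_mem_Icc (x : V) : W.cutFun x ∈ Icc (0 : ℝ) 1 := by
  refine ⟨mul_nonneg (smoothTransition.nonneg _) (smoothTransition.nonneg _), ?_⟩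
  calc W.cutLat x * W.cutVert x ≤ 1 * 1 := mul_le_mul (smoothTransition.le_one _)
        (smoothTransition.le_one _) (smoothTransition.nonneg _) zero_le_one
    _ = 1 := one_mul _

/-- `cutFun = 1` on `{‖k‖ ≤ a_lo, ‖w‖ ≤ τ/8}`. [folklore] -/
theorem cutFun_eq_one {x : V} (hk : ‖W.kf x‖ ≤ W.aLo) (hw : ‖W.wf x‖ ≤ W.τ / 8) : W.cutFun x = 1 := by
  simp [cutFun, W.cutLat_eq_one hk, W.cutVert_eq_one hw]

/-- `support cutFun ⊆ {‖k‖ < a₂ ∧ ‖w‖ < τ/5}`. [folklore] -/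
theorem support_cutFun_subset : support W.cutFun ⊆ {x | ‖W.kf x‖ < W.a₂ ∧ ‖W.wf x‖ < W.τ / 5} := by
  intro x hx
  rw [mem_support] at hx
  constructor
  · by_contra h
    exact hx (by simp [cutFun, W.cutLat_eq_zero (not_lt.1 h)])
  · by_contra h
    exact hx (by simp [cutFun, W.cutVert_eq_zero (not_lt.1 h)])

/-- `tsupport cutFun ⊆ {‖k‖ ≤ a₂ ∧ ‖w‖ ≤ τ/5}`. [folklore] -/
theorem tsupport_cutFun_subset : tsupport W.cutFun ⊆ {x | ‖W.kf x‖ ≤ W.a₂ ∧ ‖W.wf x‖ ≤ W.τ / 5} :=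
  closure_minimal (W.support_cutFun_subset.trans fun _ hx => ⟨hx.1.le, hx.2.le⟩)
    (W.isClosed_sublevel (W.a₂_lt.trans W.a₁_lt))

/-- `cutFun` is smooth. [folklore] -/
theorem contDiff_cutFun : ContDiff ℝ ∞ W.cutFun := by
  have h1 : ContDiff ℝ ∞ W.cutLat := by
    have := W.contDiff_kf.norm_sq (𝕜 := ℂ)
    exact smoothTransition.contDiff.comp ((contDiff_const.sub this).div_const _)
  have h2 : ContDiffOn ℝ ∞ W.cutVert {x | ‖W.kf x‖ < W.ρ} := by
    have := W.contDiffOn_wf.norm_sq (𝕜 := ℂ)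
    exact smoothTransition.contDiff.comp_contDiffOn ((contDiffOn_const.sub this).div_const _)
  have hsupp : tsupport W.cutLat ⊆ {x | ‖W.kf x‖ < W.ρ} := by
    refine closure_minimal (fun x hx => ?_)
      (isClosed_le (continuous_norm.comp W.contDiff_kf.continuous) continuous_const) |>.trans
      fun x (hx : ‖W.kf x‖ ≤ W.a₂) => lt_of_le_of_lt hx (W.a₂_lt.trans W.a₁_lt)
    by_contra h
    exact hx (W.cutLat_eq_zero (not_le.1 h).le)
  exact contDiff_smul_of_tsupport_subset h1 W.isOpen_chartDomain h2 hsupp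

/-- `cutFun` has compact support (given a derivative bound for the chart). [folklore] -/
theorem hasCompactSupport_cutFun {M : ℝ} (hM : ∀ k ∈ ball (0 : W.K) W.ρ, ‖fderiv ℂ W.Ψ k‖ ≤ M) :
    HasCompactSupport W.cutFun :=
  (W.isCompact_closedTube hM).of_isClosed_subset (isClosed_tsupport _)
    (W.tsupport_cutFun_subset.trans fun _ hx =>
      ⟨hx.1.trans (W.a₂_lt.le), hx.2.trans (by linarith [W.τ_pos])⟩)

/-- **The tube cutoff `χ ∈ 𝒟⁰(V)`** of the window. [cite: Federer1969, 4.1.7] -/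
def cutoff {M : ℝ} (hM : ∀ k ∈ ball (0 : W.K) W.ρ, ‖fderiv ℂ W.Ψ k‖ ≤ M) : 𝓓((⊤ : Opens V), ℝ) :=
  ⟨W.cutFun, W.contDiff_cutFun, W.hasCompactSupport_cutFun hM, subset_univ _⟩

/-- Unfolding the cutoff. [folklore] -/
@[simp] theorem cutoff_apply {M : ℝ} (hM : ∀ k ∈ ball (0 : W.K) W.ρ, ‖fderiv ℂ W.Ψ k‖ ≤ M) (x : V) :
    W.cutoff hM x = W.cutFun x := rfl

/-- `|χ| ≤ 1`. [folklore] -/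
theorem abs_cutoff_le {M : ℝ} (hM : ∀ k ∈ ball (0 : W.K) W.ρ, ‖fderiv ℂ W.Ψ k‖ ≤ M) (x : V) :
    |W.cutoff hM x| ≤ 1 := by
  rw [cutoff_apply, abs_le]
  exact ⟨by linarith [(W.cutFun_mem_Icc x).1], (W.cutFun_mem_Icc x).2⟩

/-- The open set `{‖k‖ < a_lo, ‖w‖ < τ/8}` on which `χ = 1`. [folklore] -/
def cutoffOne : Set V := {x | ‖W.kf x‖ < W.aLo ∧ ‖W.wf x‖ < W.τ / 8}

/-- `cutoffOne` is open. [folklore] -/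
theorem isOpen_cutoffOne : IsOpen W.cutoffOne := by
  have h1 : IsOpen {x : V | ‖W.kf x‖ < W.aLo} :=
    isOpen_lt (continuous_norm.comp W.contDiff_kf.continuous) continuous_const
  have h2 : IsOpen ({x : V | ‖W.kf x‖ < W.ρ} ∩ W.wf ⁻¹' ball 0 (W.τ / 8)) :=
    W.contDiffOn_wf.continuousOn.isOpen_inter_preimage W.isOpen_chartDomain isOpen_ball
  have hρ : W.aLo < W.ρ := W.aLo_lt_a₂.trans (W.a₂_lt.trans W.a₁_lt)
  have : W.cutoffOne = {x : V | ‖W.kf x‖ < W.aLo} ∩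
      ({x : V | ‖W.kf x‖ < W.ρ} ∩ W.wf ⁻¹' ball 0 (W.τ / 8)) := by
    ext x
    simp only [cutoffOne, mem_setOf_eq, mem_inter_iff, mem_preimage, mem_ball_zero_iff]
    exact ⟨fun ⟨h1, h2⟩ => ⟨h1, h1.trans hρ, h2⟩, fun ⟨h1, _, h2⟩ => ⟨h1, h2⟩⟩
  rw [this]
  exact h1.inter h2

/-- `χ = 1` on `cutoffOne`. [folklore] -/
theorem cutoff_eq_one {M : ℝ} (hM : ∀ k ∈ ball (0 : W.K) W.ρ, ‖fderiv ℂ W.Ψ k‖ ≤ M) {x : V}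
    (hx : x ∈ W.cutoffOne) : W.cutoff hM x = 1 :=
  W.cutFun_eq_one hx.1.le hx.2.le

/-- `tsupport χ ⊆ {‖k‖ ≤ a₂ ∧ ‖w‖ ≤ τ/5}`. [folklore] -/
theorem tsupport_cutoff_subset {M : ℝ} (hM : ∀ k ∈ ball (0 : W.K) W.ρ, ‖fderiv ℂ W.Ψ k‖ ≤ M) :
    tsupport ⇑(W.cutoff hM) ⊆ {x | ‖W.kf x‖ ≤ W.a₂ ∧ ‖W.wf x‖ ≤ W.τ / 5} :=
  W.tsupport_cutFun_subset

/-- `tsupport χ ⊆ innerCore ∪ {‖k‖ ≥ a₃}` refined: points of `tsupport χ` with `‖k‖ < a₃` lie in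
the inner core. [folklore] -/
theorem mem_innerCore_of_tsupport_cutoff {M : ℝ} (hM : ∀ k ∈ ball (0 : W.K) W.ρ, ‖fderiv ℂ W.Ψ k‖ ≤ M)
    {x : V} (hx : x ∈ tsupport ⇑(W.cutoff hM)) (hk : ‖W.kf x‖ < W.a₃) : x ∈ W.innerCore :=
  ⟨hk, lt_of_le_of_lt (W.tsupport_cutoff_subset hM hx).2 (by linarith [W.τ_pos])⟩

end ChartWindow

end Literature.Geometry.Kaehler
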